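import Literature.Geometry.Riemannian.CylinderSliceDerivative
import Literature.Geometry.Riemannian.CylinderNormalFormMetric
import Literature.Geometry.Riemannian.CylinderNormalFormChart
import Literature.Geometry.Riemannian.CylinderNormalFormRegionA
import Literature.Geometry.Riemannian.CylinderNormalFormRegionB
import Literature.Geometry.Riemannian.CylinderChartLocalBounds
import Literature.Geometry.Riemannian.CylinderNormalFormPositivity
import Literature.Geometry.Riemannian.NormalFormCutoffA
import Literature.Geometry.Riemannian.BaerHankeCutoff
import Literature.Geometry.Lorentzian.MetricLocality
import Literature.Geometry.Lorentzian.CurvatureRegularity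
import Literature.Geometry.Lorentzian.LeviCivitaProofs
import HarnessLib

/-!
# Bär–Hanke 2023, Thm. 27: the cylinder deformation (Props. 23 and 26 assembled)

Topic `Literature/Geometry/Riemannian`. The core (K5e of the notes) of the proof of the named fact
`Literature.Geometry.Riemannian.BarHanke2023_thm27_umbilicNormalForm`: the statement
`cylinderDeformation_core` is *verbatim* the hypothesis `hcore` of
`BarHanke2023_thm27_umbilicNormalForm_of_cylinderDeformation` (`BaerHankeNormalFormProofs.lean`),
i.e. Bär–Hanke's Props. 23 and 26 on a compact generalized cylinder `(N × ℝ, G = g_t + dt²)` with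
`scal_G > 0` on `N × [0, ε]` and `H_{g} + nμ ≤ 0` along `N × {0}`: for all `C ≥ C₀` there is a
Riemannian cylinder metric `G'` with `G' = G` for `t > ρ₁`, `scal_{G'} > 0` on `N × [0, ρ]` and
`G'`-slices `(1 − 2μt − Ct²) g₀` on `[0, ρ₀]` (`C`-normal form with umbilic second fundamental
form `μ g₀`).

## Proof (following Bär–Hanke, §3, pp. 10–13)

`G'_{(z,t)} = (1 − a(t)) G_{(z,t)} + a(t) (P_t(z) ⊕ dt²)`,
`P_t = (1 − (Ct² + 2μχ(t))) g₀ + (t − χ(t)) ġ₀` (`CylinderNormalFormMetric.exists_cylNormalDeform`),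
with `ġ₀` the smooth section of `CylinderSliceDerivative.lean`, `a` the even logarithmic cutoff
(`NormalFormCutoffA.lean`, scale `ε_L`, `a ≡ 1` on `|t| ≤ δ_L ε_L`) and `χ = τ_δ` the cutoff of
Lemma 25 (`BaerHankeCutoff.lean`). Constants: a finite subcover of the compact `N` by the chart
neighbourhoods of `CylinderChartLocalBounds.exists_local_chart_bounds` gives a uniform bound `bb`
of all chart data; `m₀ = min scal_G > 0` on `N × [0, ε]`; `C₀ = max(K_B + 1, 4bb² + 1)` with
`K_B = 2042 n² b'⁵ + 4 n b'³ (L + c₀)` the loss of step B. Given `C ≥ C₀` one chooses `ε_L`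
(smallness of step A and `8500 n² bb⁸ (1+C) ε_L ≤ m₀/4`), then `δ_L` (`η = C_a/|log δ_L|` with
`8500 n² bb⁸ (1+C) η ≤ m₀/4`), then `δ = s*²` (`s* ≤ δ_Lε_L/2`, `C s* ≤ 1`,
`24 n b'³ bb² s* ≤ 1`). Positivity of `scal_{G'}` on `N × [0, ρ]`, `ρ = (ε_L + ε)/2`:
on `[0, √δ]` by `regionB_scalarCurvature_lower_bound` (`≥ C − K_B > 0`), on `(√δ, ε_L]` by
`regionA_scalarCurvature_lower_bound` (`≥ m₀/2 > 0`), on `(ε_L, ρ]` by locality (`G' = G`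
there). `G'` is Riemannian by `taylorSlice_pos`. Everything is proved; no definitions, no named
facts (D-0026).

## References

* C. Bär, B. Hanke, *Boundary conditions for scalar curvature*, arXiv:2012.09127, §3, Def. 21,
  Props. 23, 26, Lemmas 24, 25, Thm. 27. [BarHanke2023]
-/

noncomputable section

set_option maxSynthPendingDepth 3

open Bundle Set Filter Function Metric TopologicalSpace
open scoped Manifold ContDiff Topology

namespace Literature.Geometry.Riemannian

open Literature.Geometry.Lorentzian
open Literature.Geometry.Lorentzian.PseudoRiemannianMetric
open Literature.Geometry.Lorentzian.MetricCoord

/-- Derivatives of a function which is constant on an open interval vanish there (to second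
order). [folklore] -/
theorem deriv_eq_zero_of_eqOn_Ioo {f : ℝ → ℝ} {c r₁ r₂ t : ℝ} (h₁ : r₁ < t) (h₂ : t < r₂)
    (hf : ∀ u ∈ Ioo r₁ r₂, f u = c) : deriv f t = 0 ∧ deriv (deriv f) t = 0 := by
  have hd : ∀ u ∈ Ioo r₁ r₂, deriv f u = 0 := fun u hu ↦ by
    have hev : f =ᶠ[𝓝 u] fun _ ↦ c := by
      filter_upwards [Ioo_mem_nhds hu.1 hu.2] with w hw
      exact hf w hw
    rw [hev.deriv_eq, deriv_const]
  refine ⟨hd t ⟨h₁, h₂⟩, ?_⟩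
  have hev : deriv f =ᶠ[𝓝 t] fun _ ↦ (0 : ℝ) := by
    filter_upwards [Ioo_mem_nhds h₁ h₂] with w hw
    exact hd w hw
  rw [hev.deriv_eq, deriv_const]

section PointEstimates

variable {E' : Type*} [NormedAddCommGroup E'] [InnerProductSpace ℝ E'] [FiniteDimensional ℝ E']
  {N : Type*} [TopologicalSpace N] [ChartedSpace E' N] [IsManifold 𝓘(ℝ, E') ∞ N]
  (G G' : PseudoRiemannianMetric (𝓘(ℝ, E').prod 𝓘(ℝ, ℝ)) ∞ (E' × ℝ)
    (TangentSpace (𝓘(ℝ, E').prod 𝓘(ℝ, ℝ)) : N × ℝ → Type _)) [G.HasLeviCivita] [G'.HasLeviCivita]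
  {ψ : OpenPartialHomeomorph N E'}
  (hG : G.IsRiemannian) (hG' : G'.IsRiemannian)
  (hcyl : ∀ (p : N × ℝ) (v w : TangentSpace (𝓘(ℝ, E').prod 𝓘(ℝ, ℝ)) p),
    G.val p v w = G.val p ((v.1, 0) : TangentSpace (𝓘(ℝ, E').prod 𝓘(ℝ, ℝ)) p)
      ((w.1, 0) : TangentSpace (𝓘(ℝ, E').prod 𝓘(ℝ, ℝ)) p) + v.2 * w.2)
  (hcyl' : ∀ (p : N × ℝ) (v w : TangentSpace (𝓘(ℝ, E').prod 𝓘(ℝ, ℝ)) p),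
    G'.val p v w = G'.val p ((v.1, 0) : TangentSpace (𝓘(ℝ, E').prod 𝓘(ℝ, ℝ)) p)
      ((w.1, 0) : TangentSpace (𝓘(ℝ, E').prod 𝓘(ℝ, ℝ)) p) + v.2 * w.2)
  (hψ : ψ ∈ IsManifold.maximalAtlas 𝓘(ℝ, E') ∞ N)
  (F : E' → ℝ → E' →L[ℝ] E' →L[ℝ] ℝ)
  (hF : ∀ (y : E') (s : ℝ), F y s = MaxAtlasChart.metricRepr
    (G.inducedMetric (fun x : N ↦ ((x, s) : N × ℝ))
      (contMDiff_pullbackBilin_holds (I := 𝓘(ℝ, E').prod 𝓘(ℝ, ℝ)) (M := N × ℝ)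
        (I' := 𝓘(ℝ, E')) (N := N))
      (isSpacelikeImmersion_cylSlice G hG s)) hψ y)
  (F' : E' → ℝ → E' →L[ℝ] E' →L[ℝ] ℝ)
  (hF' : ∀ (y : E') (s : ℝ), F' y s = MaxAtlasChart.metricRepr
    (G'.inducedMetric (fun x : N ↦ ((x, s) : N × ℝ))
      (contMDiff_pullbackBilin_holds (I := 𝓘(ℝ, E').prod 𝓘(ℝ, ℝ)) (M := N × ℝ)
        (I' := 𝓘(ℝ, E')) (N := N))
      (isSpacelikeImmersion_cylSlice G' hG' s)) hψ y)

include hcyl hcyl' hF hF'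

set_option maxSynthPendingDepth 4 in
set_option synthInstance.maxHeartbeats 400000 in
set_option maxHeartbeats 1600000 in
/-- **Region A, with the constants of the proof of Thm. 27**: for `√δ < t ≤ ε_L` the deformed
cylinder has `scal_{G'} ≥ m₀/2 > 0` (`regionA_scalarCurvature_lower_bound` with
`8500 n² bb⁸ (1+C)(t + η) ≤ m₀/2` and `C n − 4 n b² ≥ 0`).
[cite: BarHanke2023, §3, Prop. 23 and proof of Thm. 27] -/
theorem regionA_point_pos
    {μ : N → ℝ} {a χ : ℝ → ℝ} {C bb b₀ η nn εL m₀ t : ℝ} (ha : ContDiff ℝ ∞ a) (hχ : ContDiff ℝ ∞ χ)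
    (hFF' : ∀ (p : MaxAtlasChart.target ψ) (s : ℝ), F' p s = (1 - a s) • F p s +
      (a s * (1 - (C * s ^ 2 + 2 * μ (ψ.symm p) * χ s))) • F p 0 +
      (a s * (s - χ s)) • deriv (fun σ : ℝ ↦ F p σ) 0)
    {F₁ : E' → ℝ → E' →L[ℝ] E' →L[ℝ] E' →L[ℝ] ℝ}
    (hF₁ : ∀ (y : E') (s : ℝ), F₁ y s =
      (fderiv ℝ (fun q : E' × ℝ ↦ F q.1 q.2) (y, s)).comp (ContinuousLinearMap.inl ℝ E' ℝ))
    {F₂ : E' → ℝ → E' →L[ℝ] E' →L[ℝ] E' →L[ℝ] E' →L[ℝ] ℝ}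
    (hF₂ : ∀ (y : E') (s : ℝ), F₂ y s =
      (fderiv ℝ (fun q : E' × ℝ ↦ F₁ q.1 q.2) (y, s)).comp (ContinuousLinearMap.inl ℝ E' ℝ))
    (hχt : χ t = 0) (hχ' : deriv χ t = 0) (hχ'' : deriv (deriv χ) t = 0)
    (ha0 : 0 ≤ a t) (ha1 : a t ≤ 1) (ha' : |deriv a t| * t ≤ η)
    (ha'' : |deriv (deriv a) t| * t ^ 2 ≤ η)
    (hnn : (Module.finrank ℝ E' : ℝ) = nn) (hnn0 : 0 ≤ nn)
    (hb₀1 : 1 ≤ b₀) (hb₀ : b₀ ≤ bb) (hbb1 : 1 ≤ bb) (hC0 : 0 ≤ C) (hC4 : 4 * bb ^ 2 + 1 ≤ C)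
    (hη0 : 0 ≤ η) (hη1 : η ≤ 1) (ht0 : 0 < t) (htεL : t ≤ εL) (hεLone : εL ≤ 1)
    (hεL1 : 40 * bb ^ 4 * (1 + C) * εL ≤ 1)
    (hQεL : 34000 * nn ^ 2 * bb ^ 8 * (1 + C) * εL ≤ m₀)
    (hQη : 34000 * nn ^ 2 * bb ^ 8 * (1 + C) * η ≤ m₀) (hm₀ : 0 < m₀)
    (p : MaxAtlasChart.target ψ) (hm : m₀ ≤ G.scalarCurvature (ψ.symm p, t))
    (hs : ‖sharpAt (fun y ↦ F y t) p‖ ≤ b₀) (h1 : ‖F₁ p t‖ ≤ b₀) (h2 : ‖F₂ p t‖ ≤ b₀)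
    (hF00 : ‖F p 0‖ ≤ b₀) (hFd : ‖deriv (fun s : ℝ ↦ F p s) t‖ ≤ b₀)
    (hFdd : ‖deriv (deriv (fun s : ℝ ↦ F p s)) t‖ ≤ b₀)
    (hL0 : ‖F p t - F p 0‖ ≤ b₀ * |t|)
    (hL1 : ‖deriv (fun s : ℝ ↦ F p s) t - deriv (fun s : ℝ ↦ F p s) 0‖ ≤ b₀ * |t|)
    (hT0 : ‖F p t - F p 0 - t • deriv (fun s : ℝ ↦ F p s) 0‖ ≤ b₀ * t ^ 2)
    (h10 : ‖F₁ p 0‖ ≤ b₀) (hT1 : ‖F₁ p t - F₁ p 0 - t • deriv (F₁ p) 0‖ ≤ b₀ * t ^ 2)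
    (h20 : ‖F₂ p 0‖ ≤ b₀) (hT2 : ‖F₂ p t - F₂ p 0 - t • deriv (F₂ p) 0‖ ≤ b₀ * t ^ 2) :
    0 < G'.scalarCurvature (ψ.symm p, t) := by
  have hb₀0 : 0 ≤ b₀ := zero_le_one.trans hb₀1
  have hC1' : 0 ≤ 1 + C := by linarith only [hC0]
  have ht1 : t ≤ 1 := htεL.trans hεLone
  have hεL0 : 0 ≤ εL := ht0.le.trans htεL
  have hb4 : 1 ≤ bb ^ 4 := one_le_pow₀ hbb1
  have hbb24 : bb ^ 2 ≤ bb ^ 4 := pow_le_pow_right₀ hbb1 (by norm_num)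
  have hCεL : (1 + C) * εL ≤ 1 / 40 := by
    have h : (1 + C) * εL ≤ bb ^ 4 * ((1 + C) * εL) := le_mul_of_one_le_left (by positivity) hb4
    linarith only [h, hεL1]
  -- smallness
  have hsmall₂ : (1 + C) * t ≤ 1 := by
    linarith only [mul_le_mul_of_nonneg_left htεL hC1', hCεL]
  have hb2 : b₀ ^ 2 ≤ bb ^ 2 := pow_le_pow_left₀ hb₀0 hb₀ 2
  have hb24 : b₀ ^ 2 ≤ bb ^ 4 := hb2.trans hbb24
  have hsmall₁ : 4 * b₀ ^ 2 * (1 + C) * t ^ 2 ≤ 1 := by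
    have h3 : (1 + C) * t ^ 2 ≤ (1 + C) * εL := by
      have : t ^ 2 ≤ εL := by nlinarith only [htεL, ht1, ht0.le, hεL0]
      gcongr
    have h5 : 0 ≤ bb ^ 4 * ((1 + C) * εL) := by positivity
    calc 4 * b₀ ^ 2 * (1 + C) * t ^ 2 = 4 * b₀ ^ 2 * ((1 + C) * t ^ 2) := by ring
      _ ≤ 4 * bb ^ 4 * ((1 + C) * εL) := by gcongr
      _ ≤ 1 := by linarith only [hεL1, h5]
  have hsmall₃ : 40 * b₀ ^ 2 * t ≤ 1 := by
    have h5 : 0 ≤ 40 * bb ^ 4 * (C * εL) := by positivity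
    calc 40 * b₀ ^ 2 * t ≤ 40 * bb ^ 4 * εL := by gcongr
      _ ≤ 40 * bb ^ 4 * ((1 + C) * εL) := by linarith only [h5]
      _ ≤ 1 := by linarith only [hεL1]
  have key := regionA_scalarCurvature_lower_bound G G' hG hG' hcyl hcyl' hψ F hF F' hF'
    ha hχ hFF' hF₁ hF₂ hχt hχ' hχ'' ha0 ha1 ha' ha'' hb₀1 hC0 hη0
    hη1 ht0 ht1 hsmall₁ hsmall₂ hsmall₃ p hs h1 h2 hF00 hFd hFdd hL0 hL1 hT0 h10 hT1 h20 hT2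
  rw [hnn] at key
  -- `scal_G ≥ m₀`, the losses are `≤ m₀/4` each, and `C n − 4 n b² ≥ 0`
  have hb8 : b₀ ^ 8 ≤ bb ^ 8 := pow_le_pow_left₀ hb₀0 hb₀ 8
  have hloss : 8500 * nn ^ 2 * b₀ ^ 8 * (1 + C) * (t + η) ≤ m₀ / 2 := by
    have h1 : 8500 * nn ^ 2 * b₀ ^ 8 * (1 + C) * (t + η) ≤
        8500 * nn ^ 2 * bb ^ 8 * (1 + C) * (εL + η) := by gcongr
    linarith only [h1, hQεL, hQη]
  have hgain : 0 ≤ a t * (C * nn - 4 * nn * b₀ ^ 2) := by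
    have h2' : 0 ≤ C - 4 * b₀ ^ 2 := by linarith only [hC4, hb2]
    have h2 : 0 ≤ C * nn - 4 * nn * b₀ ^ 2 := by linarith only [mul_nonneg hnn0 h2']
    exact mul_nonneg ha0 h2
  linarith only [key, hm, hloss, hgain, hm₀]

set_option maxSynthPendingDepth 4 in
set_option synthInstance.maxHeartbeats 400000 in
set_option maxHeartbeats 1600000 in
/-- **Region B, with the constants of the proof of Thm. 27**: for `0 ≤ t ≤ √δ` the deformed
cylinder has `scal_{G'} ≥ C − K_B > 0` (`regionB_scalarCurvature_lower_bound` with the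
`C²`-distance `d = Ct²bb + |t − χ|bb + 8|χ|bb² ≤ 6√δ bb²` and the dichotomy of Lemma 25).
[cite: BarHanke2023, §3, Prop. 26 and proof of Thm. 27] -/
theorem regionB_point_pos
    {μ : N → ℝ} (hμ : ContMDiff 𝓘(ℝ, E') 𝓘(ℝ, ℝ) ∞ μ)
    {a χ : ℝ → ℝ} {C bb b₀ b' c₀ nn sst δ t : ℝ} (ha : ContDiff ℝ ∞ a) (hχ : ContDiff ℝ ∞ χ)
    (hFF' : ∀ (p : MaxAtlasChart.target ψ) (s : ℝ), F' p s = (1 - a s) • F p s +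
      (a s * (1 - (C * s ^ 2 + 2 * μ (ψ.symm p) * χ s))) • F p 0 +
      (a s * (s - χ s)) • deriv (fun σ : ℝ ↦ F p σ) 0)
    {F₁ : E' → ℝ → E' →L[ℝ] E' →L[ℝ] E' →L[ℝ] ℝ}
    (hF₁ : ∀ (y : E') (s : ℝ), F₁ y s =
      (fderiv ℝ (fun q : E' × ℝ ↦ F q.1 q.2) (y, s)).comp (ContinuousLinearMap.inl ℝ E' ℝ))
    {F₂ : E' → ℝ → E' →L[ℝ] E' →L[ℝ] E' →L[ℝ] E' →L[ℝ] ℝ}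
    (hF₂ : ∀ (y : E') (s : ℝ), F₂ y s =
      (fderiv ℝ (fun q : E' × ℝ ↦ F₁ q.1 q.2) (y, s)).comp (ContinuousLinearMap.inl ℝ E' ℝ))
    (hat : a t = 1) (hat' : deriv a t = 0) (hat'' : deriv (deriv a) t = 0)
    (hnn : (Module.finrank ℝ E' : ℝ) = nn) (hnn1 : 1 ≤ nn)
    (hb₀1 : 1 ≤ b₀) (hb₀ : b₀ ≤ bb) (hbb1 : 1 ≤ bb) (hc₀ : 0 ≤ c₀) (hC0 : 0 ≤ C)
    (hb'def : b' = bb * bb + bb + (3 + 2 * bb * c₀ + c₀) * bb)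
    (hsst2 : 24 * nn * b' ^ 3 * bb ^ 2 * sst ≤ 1) (hsstC : C * sst ≤ 1) (hsst0 : 0 < sst)
    (hδ0 : 0 < δ) (hδsst : δ ≤ sst) (ht0 : 0 ≤ t) (htsst : t ≤ sst)
    (hχb : 0 ≤ χ t ∧ χ t ≤ δ / 2) (hχd : |deriv χ t| ≤ c₀)
    (hχd2a : t ≤ δ → -(2 / δ) ≤ deriv (deriv χ) t ∧ deriv (deriv χ) t ≤ 0)
    (hχd2b : δ < t → |deriv (deriv χ) t| ≤ c₀)
    (hCKB : 2042 * nn ^ 2 * b' ^ 5 + 4 * nn * b' ^ 3 * (12 * bb ^ 2 + c₀) + 1 ≤ C)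
    (p : MaxAtlasChart.target ψ)
    (hs : ‖sharpAt (fun y ↦ F y 0) p‖ ≤ b₀) (h10 : ‖F₁ p 0‖ ≤ b₀) (h20 : ‖F₂ p 0‖ ≤ b₀)
    (hF00 : ‖F p 0‖ ≤ b₀) (hFd0 : ‖deriv (fun s : ℝ ↦ F p s) 0‖ ≤ b₀)
    (h1d : ‖deriv (F₁ p) 0‖ ≤ b₀) (h2d : ‖deriv (F₂ p) 0‖ ≤ b₀)
    (hμ0 : |μ (ψ.symm p)| ≤ b₀) (hμ1 : ‖fderiv ℝ (fun y : E' ↦ μ (ψ.symm y)) p‖ ≤ b₀)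
    (hμ2 : ‖fderiv ℝ (fderiv ℝ (fun y : E' ↦ μ (ψ.symm y))) p‖ ≤ b₀)
    (hμH : G.meanCurvature (fun y : N ↦ ((y, (0 : ℝ)) : N × ℝ))
        (contMDiff_pullbackBilin_holds (I := 𝓘(ℝ, E').prod 𝓘(ℝ, ℝ)) (M := N × ℝ)
          (I' := 𝓘(ℝ, E')) (N := N))
        (isSpacelikeImmersion_cylSlice G hG 0)
        (fun y ↦ velocity (𝓘(ℝ, E').prod 𝓘(ℝ, ℝ)) (fun s : ℝ ↦ ((y, s) : N × ℝ)) 0) (ψ.symm p) +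
      nn * μ (ψ.symm p) ≤ 0) :
    0 < G'.scalarCurvature (ψ.symm p, t) := by
  have hb₀0 : 0 ≤ b₀ := zero_le_one.trans hb₀1
  have hbb0 : 0 ≤ bb := zero_le_one.trans hbb1
  have hnn0 : 0 ≤ nn := zero_le_one.trans hnn1
  have hbb12 : bb ≤ bb ^ 2 := by nlinarith only [hbb1]
  have hb'aux : 0 ≤ (3 + 2 * bb * c₀ + c₀) * bb := by positivity
  have hbbsq : 1 ≤ bb * bb := one_le_mul_of_one_le_of_one_le hbb1 hbb1
  have hb'1 : 1 ≤ b' := by rw [hb'def]; linarith only [hbbsq, hb'aux, hbb0]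
  have hb'0 : 0 ≤ b' := zero_le_one.trans hb'1
  have hbbb' : bb ≤ b' := by rw [hb'def]; linarith only [hbbsq, hb'aux]
  have hL0 : (0 : ℝ) ≤ 12 * bb ^ 2 := by positivity
  -- the `C²`-distance `d`
  let d : ℝ := C * t ^ 2 * bb + |t - χ t| * bb + 8 * |χ t| * bb ^ 2
  have hddef : d = C * t ^ 2 * bb + |t - χ t| * bb + 8 * |χ t| * bb ^ 2 := rfl
  have habs1 : |t - χ t| ≤ sst := by
    rw [abs_le]; constructor <;> linarith only [ht0, htsst, hχb.1, hχb.2, hδsst]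
  have habs2 : |χ t| ≤ δ / 2 := by rw [abs_of_nonneg hχb.1]; exact hχb.2
  have hd0 : 0 ≤ d := by rw [hddef]; positivity
  have hd6 : d ≤ 6 * sst * bb ^ 2 := by
    have h1 : C * t ^ 2 * bb ≤ sst * bb := by
      have : C * t ^ 2 ≤ sst := by
        calc C * t ^ 2 = (C * t) * t := by ring
          _ ≤ (C * sst) * sst := by gcongr
          _ ≤ 1 * sst := by gcongr
          _ = sst := one_mul _
      gcongr
    have h2 : |t - χ t| * bb ≤ sst * bb := by gcongr
    have h3 : 8 * |χ t| * bb ^ 2 ≤ 4 * sst * bb ^ 2 := by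
      calc 8 * |χ t| * bb ^ 2 ≤ 8 * (δ / 2) * bb ^ 2 := by gcongr
        _ = 4 * δ * bb ^ 2 := by ring
        _ ≤ 4 * sst * bb ^ 2 := by gcongr
    have h4 : sst * bb ≤ sst * bb ^ 2 := mul_le_mul_of_nonneg_left hbb12 hsst0.le
    rw [hddef]; linarith only [h1, h2, h3, h4]
  have hbd' : b' * d ≤ 2⁻¹ := by
    have h1 : b' * d ≤ b' * (6 * sst * bb ^ 2) := by gcongr
    have h2 : b' ≤ nn * b' ^ 3 := by
      calc b' = 1 * (b' * 1 * 1) := by ring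
        _ ≤ nn * (b' * b' * b') := by gcongr
        _ = nn * b' ^ 3 := by ring
    have h3 : b' * (6 * sst * bb ^ 2) ≤ (nn * b' ^ 3) * (6 * sst * bb ^ 2) :=
      mul_le_mul_of_nonneg_right h2 (by positivity)
    linarith only [h1, h3, hsst2]
  have hnd' : 2 * (Module.finrank ℝ E' : ℝ) * b' ^ 3 * d ≤ 2⁻¹ := by
    rw [hnn]
    have h1 : 2 * nn * b' ^ 3 * d ≤ 2 * nn * b' ^ 3 * (6 * sst * bb ^ 2) := by gcongr
    linarith only [h1, hsst2]
  have hdd : C * t ^ 2 * b₀ + |t - χ t| * b₀ + 8 * |χ t| * b₀ ^ 2 ≤ d := by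
    rw [hddef]; gcongr
  have hWb : b₀ * b₀ + b₀ ≤ b' := by
    rw [hb'def]; linarith only [mul_le_mul hb₀ hb₀ hb₀0 hbb0, hb₀, hb'aux]
  have hhb : (2 * C * t + 2 * b₀ * |deriv χ t|) * b₀ + (1 + |deriv χ t|) * b₀ ≤ b' := by
    have h1 : 2 * C * t ≤ 2 := by linarith only [mul_le_mul_of_nonneg_left htsst hC0, hsstC]
    have h2 : 2 * b₀ * |deriv χ t| ≤ 2 * bb * c₀ := by gcongr
    have h3 : (1 + |deriv χ t|) * b₀ ≤ (1 + c₀) * bb := by gcongr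
    have h4 : (2 * C * t + 2 * b₀ * |deriv χ t|) * b₀ ≤ (2 + 2 * bb * c₀) * bb := by
      have : 2 * C * t + 2 * b₀ * |deriv χ t| ≤ 2 + 2 * bb * c₀ := by linarith only [h1, h2]
      have h0 : 0 ≤ 2 * C * t + 2 * b₀ * |deriv χ t| := by positivity
      exact mul_le_mul this hb₀ hb₀0 (by positivity)
    have h5 : 0 ≤ bb * bb + bb := by positivity
    rw [hb'def]; linarith only [h3, h4, h5]
  -- the dichotomy of Lemma 25
  have hcase : (deriv (deriv χ) t ≤ 0 ∧ |deriv (deriv χ) t| * d ≤ 12 * bb ^ 2) ∨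
      |deriv (deriv χ) t| ≤ c₀ := by
    by_cases htδ : t ≤ δ
    · obtain ⟨hlo, hhi⟩ := hχd2a htδ
      refine Or.inl ⟨hhi, ?_⟩
      have hδne : δ ≠ 0 := hδ0.ne'
      have habsχ : |deriv (deriv χ) t| ≤ 2 / δ := by
        rw [abs_le]; constructor <;> linarith only [hlo, hhi, div_nonneg (zero_le_two (α := ℝ)) hδ0.le]
      have habs1' : |t - χ t| ≤ δ := by
        rw [abs_le]; constructor <;> linarith only [ht0, htδ, hχb.1, hχb.2, hδ0]
      have hdδ : d ≤ δ * (6 * bb ^ 2) := by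
        have h1 : C * t ^ 2 * bb ≤ δ * bb := by
          have : C * t ^ 2 ≤ δ := by
            calc C * t ^ 2 = (C * t) * t := by ring
              _ ≤ (C * sst) * δ := by gcongr
              _ ≤ 1 * δ := by gcongr
              _ = δ := one_mul _
          gcongr
        have h2 : |t - χ t| * bb ≤ δ * bb := by gcongr
        have h3 : 8 * |χ t| * bb ^ 2 ≤ 4 * δ * bb ^ 2 := by
          calc 8 * |χ t| * bb ^ 2 ≤ 8 * (δ / 2) * bb ^ 2 := by gcongr
            _ = 4 * δ * bb ^ 2 := by ring
        have h4 : δ * bb ≤ δ * bb ^ 2 := mul_le_mul_of_nonneg_left hbb12 hδ0.le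
        rw [hddef]; linarith only [h1, h2, h3, h4]
      calc |deriv (deriv χ) t| * d ≤ (2 / δ) * (δ * (6 * bb ^ 2)) := by gcongr
        _ = 12 * bb ^ 2 := by field_simp; ring
    · push Not at htδ
      exact Or.inr (hχd2b htδ)
  -- the mean-curvature hypothesis in the form of the region-B estimate
  have hμH' : G.meanCurvature (fun y : N ↦ ((y, (0 : ℝ)) : N × ℝ))
      (contMDiff_pullbackBilin_holds (I := 𝓘(ℝ, E').prod 𝓘(ℝ, ℝ)) (M := N × ℝ)
        (I' := 𝓘(ℝ, E')) (N := N))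
      (isSpacelikeImmersion_cylSlice G hG 0)
      (fun y ↦ velocity (𝓘(ℝ, E').prod 𝓘(ℝ, ℝ)) (fun s : ℝ ↦ ((y, s) : N × ℝ)) 0) (ψ.symm p) +
      (Module.finrank ℝ E' : ℝ) * μ (ψ.symm p) ≤ 0 := by rw [hnn]; exact hμH
  have key := regionB_scalarCurvature_lower_bound G G' hG hG' hcyl hcyl' hψ F hF F' hF'
    hμ ha hχ hFF' hF₁ hF₂ hat hat' hat'' hb₀1 hb'1 hC0 hc₀ hL0 hd0
    ht0 hbd' hnd' hdd hWb hhb (hb₀.trans hbbb') hcase p hs h10 h20 hF00 hFd0 h1d h2d hμ0 hμ1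
    hμ2 hμH'
  rw [hnn] at key
  have h2n : C ≤ 2 * C * (nn - 2⁻¹) := by
    linarith only [mul_nonneg hC0 (by linarith only [hnn1] : (0:ℝ) ≤ nn - 1)]
  linarith only [key, hCKB, h2n]

end PointEstimates

set_option maxSynthPendingDepth 4 in
set_option synthInstance.maxHeartbeats 400000 in
set_option maxHeartbeats 3000000 in
/-- **The cylinder deformation of Bär–Hanke's Thm. 27** (Props. 23 and 26 on a compact
generalized cylinder): verbatim the hypothesis `hcore` of
`BarHanke2023_thm27_umbilicNormalForm_of_cylinderDeformation`.
[cite: BarHanke2023, §3, Props. 23, 26 and Thm. 27] -/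
theorem cylinderDeformation_core (m : ℕ) (N : Type) [TopologicalSpace N] [T2Space N]
    [CompactSpace N] [Nonempty N]
    [ChartedSpace (EuclideanSpace ℝ (Fin (m + 1))) N] [IsManifold (𝓡 (m + 1)) ∞ N]
    (G : PseudoRiemannianMetric ((𝓡 (m + 1)).prod 𝓘(ℝ, ℝ)) ∞
      (EuclideanSpace ℝ (Fin (m + 1)) × ℝ)
      (TangentSpace ((𝓡 (m + 1)).prod 𝓘(ℝ, ℝ)) : N × ℝ → Type _)) [G.HasLeviCivita]
    (hG : G.IsRiemannian)
    (hcyl : ∀ (p : N × ℝ) (v w : TangentSpace ((𝓡 (m + 1)).prod 𝓘(ℝ, ℝ)) p),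
      G.val p v w = G.val p ((v.1, 0) : TangentSpace ((𝓡 (m + 1)).prod 𝓘(ℝ, ℝ)) p)
        ((w.1, 0) : TangentSpace ((𝓡 (m + 1)).prod 𝓘(ℝ, ℝ)) p) + v.2 * w.2)
    (ε : ℝ) (hε : 0 < ε)
    (hpsc : ∀ (z : N), ∀ t ∈ Icc (0 : ℝ) ε, 0 < G.scalarCurvature (z, t))
    (μ : N → ℝ) (hμ : ContMDiff (𝓡 (m + 1)) 𝓘(ℝ, ℝ) ∞ μ)
    (hμH : ∀ z : N, G.meanCurvature (fun y : N ↦ ((y, (0 : ℝ)) : N × ℝ))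
        (contMDiff_pullbackBilin_holds (I := (𝓡 (m + 1)).prod 𝓘(ℝ, ℝ)) (M := N × ℝ)
          (I' := 𝓡 (m + 1)) (N := N))
        (isSpacelikeImmersion_cylSlice G hG 0)
        (fun y ↦ velocity ((𝓡 (m + 1)).prod 𝓘(ℝ, ℝ)) (fun s : ℝ ↦ ((y, s) : N × ℝ)) 0) z +
      (m + 1 : ℝ) * μ z ≤ 0) :
    ∃ C₀ : ℝ, 0 < C₀ ∧ ∀ C : ℝ, C₀ ≤ C →
      ∃ (G' : PseudoRiemannianMetric ((𝓡 (m + 1)).prod 𝓘(ℝ, ℝ)) ∞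
          (EuclideanSpace ℝ (Fin (m + 1)) × ℝ)
          (TangentSpace ((𝓡 (m + 1)).prod 𝓘(ℝ, ℝ)) : N × ℝ → Type _)) (_ : G'.HasLeviCivita)
        (ρ₀ ρ₁ ρ : ℝ),
        G'.IsRiemannian ∧
        (∀ (p : N × ℝ) (v w : TangentSpace ((𝓡 (m + 1)).prod 𝓘(ℝ, ℝ)) p),
          G'.val p v w = G'.val p ((v.1, 0) : TangentSpace ((𝓡 (m + 1)).prod 𝓘(ℝ, ℝ)) p)
            ((w.1, 0) : TangentSpace ((𝓡 (m + 1)).prod 𝓘(ℝ, ℝ)) p) + v.2 * w.2) ∧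
        0 < ρ₀ ∧ ρ₀ ≤ ρ ∧ 0 < ρ₁ ∧ ρ₁ < ρ ∧ ρ < ε ∧
        (∀ (z : N) (t : ℝ), ρ₁ < t → G'.val (z, t) = G.val (z, t)) ∧
        (∀ (z : N), ∀ t ∈ Icc (0 : ℝ) ρ, 0 < G'.scalarCurvature (z, t)) ∧
        (∀ (z : N), ∀ t ∈ Icc (0 : ℝ) ρ₀, ∀ v w : EuclideanSpace ℝ (Fin (m + 1)),
          G'.val (z, t) ((v, 0) : TangentSpace ((𝓡 (m + 1)).prod 𝓘(ℝ, ℝ)) (z, t))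
              ((w, 0) : TangentSpace ((𝓡 (m + 1)).prod 𝓘(ℝ, ℝ)) (z, t)) =
            (1 - 2 * μ z * t - C * t ^ 2) *
              G.val (z, (0 : ℝ)) ((v, 0) : TangentSpace ((𝓡 (m + 1)).prod 𝓘(ℝ, ℝ)) (z, (0 : ℝ)))
                ((w, 0) : TangentSpace ((𝓡 (m + 1)).prod 𝓘(ℝ, ℝ)) (z, (0 : ℝ)))) := by
  -- ### Step 0: the initial velocity `B = ġ₀` of the slices (a smooth symmetric section)
  obtain ⟨B, hBs, hBd⟩ := exists_sliceDeriv_contMDiff (I' := 𝓡 (m + 1)) G.val G.contMDiff 0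
  have hBsymm : ∀ (z : N) (v w : TangentSpace (𝓡 (m + 1)) z), B z v w = B z w v := by
    intro z v w
    have h1 := hBd z v w
    have h2 := hBd z w v
    have hfun : (fun t : ℝ ↦ G.val (z, t)
        ((v, 0) : TangentSpace ((𝓡 (m + 1)).prod 𝓘(ℝ, ℝ)) (z, t))
        ((w, 0) : TangentSpace ((𝓡 (m + 1)).prod 𝓘(ℝ, ℝ)) (z, t))) =
        fun t : ℝ ↦ G.val (z, t) ((w, 0) : TangentSpace ((𝓡 (m + 1)).prod 𝓘(ℝ, ℝ)) (z, t))
          ((v, 0) : TangentSpace ((𝓡 (m + 1)).prod 𝓘(ℝ, ℝ)) (z, t)) :=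
      funext fun t ↦ G.symm _ _ _
    rw [hfun] at h1
    exact h1.unique h2
  -- ### Step 1: a finite chart cover with uniform bounds `bb`
  choose S hS b hb1 hSsrc F F₁ F₂ hF hF₁ hF₂ hbd using
    fun z₀ : N ↦ exists_local_chart_bounds G hG hμ z₀
  obtain ⟨T, hT⟩ := CompactSpace.elim_nhds_subcover S hS
  have hcov : ∀ z : N, ∃ i ∈ T, z ∈ S i := fun z ↦ by
    have hz : z ∈ ⋃ x ∈ T, S x := by rw [hT]; exact mem_univ z
    simpa only [mem_iUnion, exists_prop] using hz
  let bb : ℝ := 1 + ∑ i ∈ T, b i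
  have hbb : bb = 1 + ∑ i ∈ T, b i := rfl
  have hbpos : ∀ i, 0 ≤ b i := fun i ↦ zero_le_one.trans (hb1 i)
  have hbi : ∀ i ∈ T, b i ≤ bb := fun i hi ↦ by
    have h := Finset.single_le_sum (fun j _ ↦ hbpos j) hi
    rw [hbb]; linarith only [h]
  have hbb1 : 1 ≤ bb := by
    rw [hbb]; linarith only [Finset.sum_nonneg (fun j (_ : j ∈ T) ↦ hbpos j)]
  have hbb0 : 0 ≤ bb := zero_le_one.trans hbb1
  -- ### Step 2: the positive minimum `m₀` of `scal_G` on `N × [0, ε]`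
  have hcont : Continuous G.scalarCurvature := (contMDiff_scalarCurvature G).continuous
  obtain ⟨q₀, hq₀, hq₀min⟩ := ((isCompact_univ (X := N)).prod
    (isCompact_Icc (a := (0 : ℝ)) (b := ε))).exists_isMinOn
    ⟨(Classical.arbitrary N, 0), mem_univ _, left_mem_Icc.2 hε.le⟩ hcont.continuousOn
  let m₀ : ℝ := G.scalarCurvature q₀
  have hm₀ : 0 < m₀ := by
    have h := hpsc q₀.1 q₀.2 hq₀.2
    exact h
  have hm₀le : ∀ (z : N), ∀ t ∈ Icc (0 : ℝ) ε, m₀ ≤ G.scalarCurvature (z, t) := fun z t ht ↦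
    (isMinOn_iff.1 hq₀min) (z, t) ⟨mem_univ _, ht⟩
  -- ### Step 3: the constants
  obtain ⟨c₀, hc₀, hcut⟩ := BaerHanke.exists_cutoff
  obtain ⟨Ca, hCa, hacut⟩ := BaerHanke.exists_evenLogCutoff
  obtain ⟨nn, hnndef⟩ : ∃ nn : ℝ, nn = (m + 1 : ℝ) := ⟨_, rfl⟩
  have hnn : (Module.finrank ℝ (EuclideanSpace ℝ (Fin (m + 1))) : ℝ) = nn := by
    rw [hnndef, finrank_euclideanSpace_fin, Nat.cast_add, Nat.cast_one]
  have hnn1 : 1 ≤ nn := by rw [hnndef]; linarith only [(Nat.cast_nonneg m : (0 : ℝ) ≤ m)]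
  have hnn0 : 0 ≤ nn := zero_le_one.trans hnn1
  let b' : ℝ := bb * bb + bb + (3 + 2 * bb * c₀ + c₀) * bb
  have hb'def : b' = bb * bb + bb + (3 + 2 * bb * c₀ + c₀) * bb := rfl
  have hbbsq : 1 ≤ bb * bb := one_le_mul_of_one_le_of_one_le hbb1 hbb1
  have hb'aux : 0 ≤ (3 + 2 * bb * c₀ + c₀) * bb := by
    have := hc₀.le; positivity
  have hb'1 : 1 ≤ b' := by rw [hb'def]; linarith only [hbbsq, hb'aux, hbb0]
  have hb'0 : 0 ≤ b' := zero_le_one.trans hb'1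
  have hbbb' : bb ≤ b' := by rw [hb'def]; linarith only [hbbsq, hb'aux]
  let L : ℝ := 12 * bb ^ 2
  have hLdef : L = 12 * bb ^ 2 := rfl
  have hL0 : 0 ≤ L := by rw [hLdef]; positivity
  let KB : ℝ := 2042 * nn ^ 2 * b' ^ 5 + 4 * nn * b' ^ 3 * (L + c₀)
  have hKBdef : KB = 2042 * nn ^ 2 * b' ^ 5 + 4 * nn * b' ^ 3 * (L + c₀) := rfl
  have hKB0 : 0 ≤ KB := by rw [hKBdef]; positivity
  refine ⟨max (KB + 1) (4 * bb ^ 2 + 1), lt_max_of_lt_left (by linarith only [hKB0]),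
    fun C hC ↦ ?_⟩
  have hCKB : KB + 1 ≤ C := (le_max_left _ _).trans hC
  have hC4 : 4 * bb ^ 2 + 1 ≤ C := (le_max_right _ _).trans hC
  have hC0 : 0 ≤ C := by linarith only [hCKB, hKB0]
  have hC1 : 1 ≤ C := by linarith only [hCKB, hKB0]
  have hC1' : 0 < 1 + C := by linarith only [hC0]
  -- `ε_L`
  let Q : ℝ := 34000 * nn ^ 2 * bb ^ 8 * (1 + C)
  have hQdef : Q = 34000 * nn ^ 2 * bb ^ 8 * (1 + C) := rfl
  have hQ : 0 < Q := by rw [hQdef]; positivity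
  let εL : ℝ := min (ε / 2) (min (1 / (40 * bb ^ 4 * (1 + C))) (m₀ / Q))
  have hεLdef : εL = min (ε / 2) (min (1 / (40 * bb ^ 4 * (1 + C))) (m₀ / Q)) := rfl
  have hεL0 : 0 < εL := by
    rw [hεLdef]; exact lt_min (by linarith only [hε]) (lt_min (by positivity) (by positivity))
  have hεLε : εL ≤ ε / 2 := by rw [hεLdef]; exact min_le_left _ _
  have hεL1 : 40 * bb ^ 4 * (1 + C) * εL ≤ 1 := by
    have h : εL ≤ 1 / (40 * bb ^ 4 * (1 + C)) := by
      rw [hεLdef]; exact (min_le_right _ _).trans (min_le_left _ _)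
    have h' := (le_div_iff₀ (by positivity)).1 h
    linarith only [h']
  have hεL2 : Q * εL ≤ m₀ := by
    have h : εL ≤ m₀ / Q := by rw [hεLdef]; exact (min_le_right _ _).trans (min_le_right _ _)
    have h' := (le_div_iff₀ hQ).1 h
    linarith only [h']
  have hεLone : εL ≤ 1 := by
    have : (1 : ℝ) ≤ 40 * bb ^ 4 * (1 + C) := by
      have h4 : 1 ≤ bb ^ 4 := one_le_pow₀ hbb1
      nlinarith only [h4, hC0]
    nlinarith only [hεL1, this, hεL0.le]
  -- `η` and `δ_L`
  let ηt : ℝ := min 1 (m₀ / Q)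
  have hηtdef : ηt = min 1 (m₀ / Q) := rfl
  have hηt0 : 0 < ηt := by rw [hηtdef]; exact lt_min one_pos (by positivity)
  let δL : ℝ := min (1 / 8) (Real.exp (-(Ca / ηt)))
  have hδLdef : δL = min (1 / 8) (Real.exp (-(Ca / ηt))) := rfl
  have hδL0 : 0 < δL := by rw [hδLdef]; exact lt_min (by norm_num) (Real.exp_pos _)
  have hδL8 : δL ≤ 1 / 8 := by rw [hδLdef]; exact min_le_left _ _
  have hδLexp : δL ≤ Real.exp (-(Ca / ηt)) := by rw [hδLdef]; exact min_le_right _ _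
  have hδL4 : δL < 1 / 4 := hδL8.trans_lt (by norm_num)
  let η : ℝ := Ca / |Real.log δL|
  have hηdef : η = Ca / |Real.log δL| := rfl
  have hlogδL : Real.log δL < 0 := Real.log_neg hδL0 (by linarith only [hδL4])
  have hlogabs : |Real.log δL| = -Real.log δL := abs_of_neg hlogδL
  have hη0 : 0 ≤ η := div_nonneg hCa.le (abs_nonneg _)
  have hηle : η ≤ ηt := by
    -- `δ_L ≤ exp(−C_a/η_t)` gives `|log δ_L| ≥ C_a/η_t`
    have h1 : Real.log δL ≤ -(Ca / ηt) := by
      have h := Real.log_le_log hδL0 hδLexp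
      rwa [Real.log_exp] at h
    have h2 : Ca / ηt ≤ |Real.log δL| := by rw [hlogabs]; linarith only [h1]
    rw [hηdef, div_le_iff₀ (abs_pos.2 hlogδL.ne)]
    rw [div_le_iff₀ hηt0] at h2
    linarith only [h2, mul_comm ηt |Real.log δL|]
  have hη1 : η ≤ 1 := hηle.trans (by rw [hηtdef]; exact min_le_left _ _)
  have hη2 : Q * η ≤ m₀ := by
    have h : η ≤ m₀ / Q := hηle.trans (by rw [hηtdef]; exact min_le_right _ _)
    have h' := (le_div_iff₀ hQ).1 h
    linarith only [h']
  -- the even logarithmic cutoff `a`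
  obtain ⟨a, ha_s, ha1on, ha0on, ha01, hader⟩ := hacut δL εL hδL0 hδL4 hεL0
  -- `δ = s*²` and the cutoff `χ = τ_δ`
  let sst : ℝ := min (δL * εL / 2) (min (1 / C) (1 / (24 * nn * b' ^ 3 * bb ^ 2)))
  have hsstdef : sst = min (δL * εL / 2) (min (1 / C) (1 / (24 * nn * b' ^ 3 * bb ^ 2))) := rfl
  have hsst0 : 0 < sst := by
    rw [hsstdef]; exact lt_min (by positivity) (lt_min (by positivity) (by positivity))
  have hsst1 : sst ≤ δL * εL / 2 := by rw [hsstdef]; exact min_le_left _ _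
  have hsstC : C * sst ≤ 1 := by
    have h : sst ≤ 1 / C := by rw [hsstdef]; exact (min_le_right _ _).trans (min_le_left _ _)
    have h' := (le_div_iff₀ (by linarith only [hC1])).1 h
    linarith only [h']
  have hsst2 : 24 * nn * b' ^ 3 * bb ^ 2 * sst ≤ 1 := by
    have h : sst ≤ 1 / (24 * nn * b' ^ 3 * bb ^ 2) := by
      rw [hsstdef]; exact (min_le_right _ _).trans (min_le_right _ _)
    have h' := (le_div_iff₀ (by positivity)).1 h
    linarith only [h']
  have hsstle : sst ≤ 1 / 2 := by
    have h0 : δL * εL ≤ δL := mul_le_of_le_one_right hδL0.le hεLone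
    have h1 : δL * εL / 2 ≤ 1 / 2 := by linarith only [h0, hδL4]
    exact hsst1.trans h1
  let δ : ℝ := sst ^ 2
  have hδdef : δ = sst ^ 2 := rfl
  have hδ0 : 0 < δ := by rw [hδdef]; positivity
  have hδsqrt : Real.sqrt δ = sst := by rw [hδdef, Real.sqrt_sq hsst0.le]
  have hδsst : δ ≤ sst := by rw [hδdef]; nlinarith only [hsst0.le, hsstle]
  have hδhalf : δ ≤ 1 / 2 := hδsst.trans hsstle
  obtain ⟨χ, hχ_s, hχlow, hχhigh, hχ01, hχd1, hχd2a, hχd2b⟩ := hcut δ hδ0 hδhalf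
  rw [← hηdef] at hader
  -- ### Step 4: elementary consequences of the choices
  have hb4 : 1 ≤ bb ^ 4 := one_le_pow₀ hbb1
  have hCεL : (1 + C) * εL ≤ 1 / 40 := by
    have h : (1 + C) * εL ≤ bb ^ 4 * ((1 + C) * εL) := le_mul_of_one_le_left (by positivity) hb4
    linarith only [h, hεL1]
  have hbbεL : bb ^ 4 * εL ≤ 1 / 40 := by
    have h : 0 ≤ bb ^ 4 * εL * C := by positivity
    linarith only [h, hεL1]
  have hbb14 : bb ≤ bb ^ 4 := le_self_pow₀ hbb1 (by norm_num)
  have hbb12 : bb ≤ bb ^ 2 := by nlinarith only [hbb1]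
  have hbb24 : bb ^ 2 ≤ bb ^ 4 := pow_le_pow_right₀ hbb1 (by norm_num)
  have hbb1εL : bb * εL ≤ 1 / 40 := by
    have h : bb * εL ≤ bb ^ 4 * εL := by gcongr
    linarith only [h, hbbεL]
  have hbbsst : bb * sst ≤ 1 / 24 := by
    have h1 : bb ≤ nn * b' ^ 3 * bb ^ 2 := by
      have h3 : 1 ≤ b' ^ 3 := one_le_pow₀ hb'1
      calc bb = 1 * 1 * (bb * 1) := by ring
        _ ≤ nn * b' ^ 3 * (bb * bb) := by gcongr
        _ = nn * b' ^ 3 * bb ^ 2 := by ring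
    have h2 : bb * sst ≤ (nn * b' ^ 3 * bb ^ 2) * sst := by gcongr
    linarith only [h2, hsst2]
  have hδLεL : δL * εL ≤ εL / 8 := by
    calc δL * εL ≤ (1 / 8) * εL := by gcongr
      _ = εL / 8 := by ring
  have hsstεL : sst < εL := by linarith only [hsst1, hδLεL, hεL0]
  have hsstδεL : sst < δL * εL := by linarith only [hsst1, mul_pos hδL0 hεL0]
  -- `a ≡ 1` to second order on `|t| < δ_L ε_L`
  have ha_one : ∀ t, |t| < δL * εL → a t = 1 ∧ deriv a t = 0 ∧ deriv (deriv a) t = 0 := by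
    intro t ht
    refine ⟨ha1on t ht.le, ?_⟩
    have h := abs_lt.1 ht
    exact deriv_eq_zero_of_eqOn_Ioo (c := 1) (r₁ := -(δL * εL)) (r₂ := δL * εL) h.1 h.2
      (fun u hu ↦ ha1on u (abs_le.2 ⟨hu.1.le, hu.2.le⟩))
  -- `χ ≡ 0` to second order beyond `√δ = s*`
  have hχ_zero : ∀ t, sst < t → χ t = 0 ∧ deriv χ t = 0 ∧ deriv (deriv χ) t = 0 := by
    intro t ht
    refine ⟨hχhigh t (by rw [hδsqrt]; exact ht.le), ?_⟩
    exact deriv_eq_zero_of_eqOn_Ioo (c := 0) (r₁ := sst) (r₂ := t + 1) ht (lt_add_one t)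
      (fun u hu ↦ hχhigh u (by rw [hδsqrt]; exact hu.1.le))
  -- ### Step 5: the deformed metric `G'` (positivity of the Taylor slices)
  have hPD : ∀ (z : N) (t : ℝ), a t ≠ 0 → ∀ v : EuclideanSpace ℝ (Fin (m + 1)), v ≠ 0 →
      0 < (1 - (C * t ^ 2 + 2 * μ z * χ t)) *
          G.val (z, (0 : ℝ)) ((v, 0) : TangentSpace ((𝓡 (m + 1)).prod 𝓘(ℝ, ℝ)) (z, (0 : ℝ)))
            ((v, 0) : TangentSpace ((𝓡 (m + 1)).prod 𝓘(ℝ, ℝ)) (z, (0 : ℝ))) +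
        (t - χ t) * B z v v := by
    intro z t hat v hv
    have htε : |t| < εL := by
      by_contra h
      push Not at h
      exact hat (ha0on t h)
    have ht1 : |t| ≤ 1 := htε.le.trans hεLone
    obtain ⟨i, hi, hz⟩ := hcov z
    have hzsrc : z ∈ (chartAt (EuclideanSpace ℝ (Fin (m + 1))) i).source := hSsrc i hz
    have hψ : chartAt (EuclideanSpace ℝ (Fin (m + 1))) i ∈
        IsManifold.maximalAtlas (𝓡 (m + 1)) ∞ N := IsManifold.chart_mem_maximalAtlas i
    let p : MaxAtlasChart.target (chartAt (EuclideanSpace ℝ (Fin (m + 1))) i) :=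
      ⟨chartAt (EuclideanSpace ℝ (Fin (m + 1))) i z,
        (chartAt (EuclideanSpace ℝ (Fin (m + 1))) i).map_source hzsrc⟩
    have hpz : (chartAt (EuclideanSpace ℝ (Fin (m + 1))) i).symm
        (p : EuclideanSpace ℝ (Fin (m + 1))) = z :=
      (chartAt (EuclideanSpace ℝ (Fin (m + 1))) i).left_inv hzsrc
    -- `v = dψ⁻¹ (dψ v)`
    have hcomp := (MaxAtlasChart.mdifferentiable_chart hψ).symm_comp_deriv hzsrc
    have hv' : mfderiv (𝓡 (m + 1)) (𝓡 (m + 1)) (chartAt (EuclideanSpace ℝ (Fin (m + 1))) i).symm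
        (p : EuclideanSpace ℝ (Fin (m + 1)))
        (mfderiv (𝓡 (m + 1)) (𝓡 (m + 1)) (chartAt (EuclideanSpace ℝ (Fin (m + 1))) i) z v) = v := by
      have h := ContinuousLinearMap.ext_iff.1 hcomp v
      exact h
    have hw0 : mfderiv (𝓡 (m + 1)) (𝓡 (m + 1)) (chartAt (EuclideanSpace ℝ (Fin (m + 1))) i) z v ≠ 0 := by
      intro h0
      apply hv
      rw [← hv', h0]
      exact map_zero _
    obtain ⟨⟨e1, e2, -, -, -, -⟩, -, -, hsh, hμa, -, -⟩ := hbd i z hz 0 ⟨by norm_num, by norm_num⟩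
    rw [(chartAt (EuclideanSpace ℝ (Fin (m + 1))) i).left_inv hzsrc] at hμa
    have hμz : |μ z| ≤ bb := hμa.trans (hbi i hi)
    have hb4i : (b i) ^ 4 ≤ bb ^ 4 := pow_le_pow_left₀ (hbpos i) (hbi i hi) 4
    -- `|κ| + |e| b⁴ < 1`
    have hκe : |C * t ^ 2 + 2 * μ z * χ t| + |t - χ t| * (b i) ^ 4 < 1 := by
      have ht2 : C * t ^ 2 ≤ 1 / 40 := by
        have : t ^ 2 ≤ εL := by
          calc t ^ 2 = |t| * |t| := by rw [← sq_abs]; ring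
            _ ≤ εL * 1 := by gcongr
            _ = εL := mul_one _
        nlinarith only [this, hCεL, hC0, hεL0.le]
      rcases le_or_gt t 0 with ht0 | ht0
      · -- `t ≤ 0`: `χ t = t`, `e = 0`
        have hχt : χ t = t := hχlow t (by linarith only [ht0, hδ0])
        rw [hχt, sub_self, abs_zero, zero_mul, add_zero]
        have h2 : |2 * μ z * t| ≤ 2 * (1 / 40) := by
          rw [abs_mul, abs_mul, abs_of_pos (by norm_num : (0:ℝ) < 2)]
          calc 2 * |μ z| * |t| ≤ 2 * bb * εL := by gcongr
            _ = 2 * (bb * εL) := by ring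
            _ ≤ 2 * (1 / 40) := by gcongr
        calc |C * t ^ 2 + 2 * μ z * t| ≤ |C * t ^ 2| + |2 * μ z * t| := abs_add_le _ _
          _ ≤ 1 / 40 + 2 * (1 / 40) := by
              rw [abs_of_nonneg (by positivity)]; gcongr
          _ < 1 := by norm_num
      · -- `t > 0`: `0 ≤ χ t ≤ δ/2`
        obtain ⟨hχb1, hχb2⟩ := hχ01 t ht0.le
        have ht' : t < εL := (le_abs_self t).trans_lt htε
        have h2 : |2 * μ z * χ t| ≤ 1 / 24 := by
          rw [abs_mul, abs_mul, abs_of_pos (by norm_num : (0:ℝ) < 2), abs_of_nonneg hχb1]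
          calc 2 * |μ z| * χ t ≤ 2 * bb * (δ / 2) := by gcongr
            _ = bb * δ := by ring
            _ ≤ bb * sst := by gcongr
            _ ≤ 1 / 24 := hbbsst
        have h3 : |t - χ t| ≤ εL := by
          rw [abs_le]; constructor <;> linarith only [ht0, ht', hχb1, hχb2, hδsst, hsstεL]
        have h4 : |t - χ t| * (b i) ^ 4 ≤ 1 / 40 := by
          calc |t - χ t| * (b i) ^ 4 ≤ εL * bb ^ 4 := by gcongr
            _ = bb ^ 4 * εL := mul_comm _ _
            _ ≤ 1 / 40 := hbbεL
        calc |C * t ^ 2 + 2 * μ z * χ t| + |t - χ t| * (b i) ^ 4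
            ≤ (|C * t ^ 2| + |2 * μ z * χ t|) + 1 / 40 := add_le_add (abs_add_le _ _) h4
          _ ≤ (1 / 40 + 1 / 24) + 1 / 40 := by rw [abs_of_nonneg (by positivity)]; gcongr
          _ < 1 := by norm_num
    have key := taylorSlice_pos G hG hψ (F i) (hF i) hBd p (hb1 i) hsh e1 e2 hκe hw0
    rw [hv'] at key
    rw [hpz] at key
    exact key
  obtain ⟨G', hG'R, hcyl', hval⟩ :=
    exists_cylNormalDeform G hG hcyl B hBs hBsymm μ hμ a χ ha_s hχ_s ha01 C hPD
  haveI : Fact (1 ≤ (∞ : ℕ∞ω)) := ⟨by exact_mod_cast le_top⟩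
  haveI hLC' : G'.HasLeviCivita := G'.hasLeviCivita
  -- ### Step 6: positivity of the scalar curvature on `N × [0, ρ]`
  have hscal : ∀ (z : N), ∀ t ∈ Icc (0 : ℝ) ((εL + ε) / 2), 0 < G'.scalarCurvature (z, t) := by
    intro z t ht
    rcases lt_or_ge εL t with hA | hA
    · -- `t > ε_L`: `G' = G` near `(z, t)`
      have hU : IsOpen ((univ : Set N) ×ˢ Ioi εL) := isOpen_univ.prod isOpen_Ioi
      have hgg' : ∀ x ∈ (univ : Set N) ×ˢ Ioi εL, G'.val x = G.val x := by
        intro x hx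
        have hx2 : εL < x.2 := hx.2
        exact cylNormalDeform_val_of_eq_zero G hval
          (ha0on x.2 (by rw [abs_of_pos (hεL0.trans hx2)]; exact hx2.le)) x.1
      rw [scalarCurvature_eq_of_eqOn G G' hU hgg' (x := (z, t)) ⟨mem_univ _, hA⟩]
      exact hpsc z t ⟨ht.1, by linarith only [ht.2, hεLε, hε]⟩
    -- `t ≤ ε_L`: work in a chart of the cover at `z`
    obtain ⟨i, hi, hz⟩ := hcov z
    have hzsrc : z ∈ (chartAt (EuclideanSpace ℝ (Fin (m + 1))) i).source := hSsrc i hz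
    have hψ : chartAt (EuclideanSpace ℝ (Fin (m + 1))) i ∈
        IsManifold.maximalAtlas (𝓡 (m + 1)) ∞ N := IsManifold.chart_mem_maximalAtlas i
    let p : MaxAtlasChart.target (chartAt (EuclideanSpace ℝ (Fin (m + 1))) i) :=
      ⟨chartAt (EuclideanSpace ℝ (Fin (m + 1))) i z,
        (chartAt (EuclideanSpace ℝ (Fin (m + 1))) i).map_source hzsrc⟩
    have hpz : (chartAt (EuclideanSpace ℝ (Fin (m + 1))) i).symm
        (p : EuclideanSpace ℝ (Fin (m + 1))) = z :=
      (chartAt (EuclideanSpace ℝ (Fin (m + 1))) i).left_inv hzsrc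
    have hbib : b i ≤ bb := hbi i hi
    have hb0i : 0 ≤ b i := hbpos i
    -- the components of `G'` in the chart and the chart identity
    let F' : EuclideanSpace ℝ (Fin (m + 1)) → ℝ →
        EuclideanSpace ℝ (Fin (m + 1)) →L[ℝ] EuclideanSpace ℝ (Fin (m + 1)) →L[ℝ] ℝ :=
      fun y s ↦ MaxAtlasChart.metricRepr
        (G'.inducedMetric (fun x : N ↦ ((x, s) : N × ℝ))
          (contMDiff_pullbackBilin_holds (I := (𝓡 (m + 1)).prod 𝓘(ℝ, ℝ)) (M := N × ℝ)
            (I' := 𝓡 (m + 1)) (N := N))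
          (isSpacelikeImmersion_cylSlice G' hG'R s)) hψ y
    have hF' : ∀ y s, F' y s = MaxAtlasChart.metricRepr
        (G'.inducedMetric (fun x : N ↦ ((x, s) : N × ℝ))
          (contMDiff_pullbackBilin_holds (I := (𝓡 (m + 1)).prod 𝓘(ℝ, ℝ)) (M := N × ℝ)
            (I' := 𝓡 (m + 1)) (N := N))
          (isSpacelikeImmersion_cylSlice G' hG'R s)) hψ y := fun _ _ ↦ rfl
    have hFF' := normalFormComponents_eq G G' hG hG'R hψ (F i) (hF i) F' hF' hval hBd
    -- bounds at time `0`
    obtain ⟨⟨e10, e20, -, -, -, -⟩, ⟨f10, f20, -, -, -, -⟩, ⟨g10, g20, -, -, -, -⟩, hsh0, hμa, hμb,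
      hμc⟩ := hbd i z hz 0 ⟨by norm_num, by norm_num⟩
    rcases le_or_gt t sst with hB | hB
    · -- #### region B: `0 ≤ t ≤ √δ`
      obtain ⟨hat, hat', hat''⟩ := ha_one t (by rw [abs_of_nonneg ht.1]; linarith only [hB, hsstδεL])
      have hχd2a' : t ≤ δ → -(2 / δ) ≤ deriv (deriv χ) t ∧ deriv (deriv χ) t ≤ 0 := fun htδ ↦ by
        have h := hχd2a t ht.1 htδ
        rwa [neg_div] at h
      have hχd2b' : δ < t → |deriv (deriv χ) t| ≤ c₀ := fun hδt ↦
        hχd2b t hδt.le (by rw [hδsqrt]; exact hB)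
      have hCKB' : 2042 * nn ^ 2 * b' ^ 5 + 4 * nn * b' ^ 3 * (12 * bb ^ 2 + c₀) + 1 ≤ C := by
        have h := hCKB; rw [hKBdef, hLdef] at h; exact h
      have hμHz : G.meanCurvature (fun y : N ↦ ((y, (0 : ℝ)) : N × ℝ))
          (contMDiff_pullbackBilin_holds (I := (𝓡 (m + 1)).prod 𝓘(ℝ, ℝ)) (M := N × ℝ)
            (I' := 𝓡 (m + 1)) (N := N))
          (isSpacelikeImmersion_cylSlice G hG 0)
          (fun y ↦ velocity ((𝓡 (m + 1)).prod 𝓘(ℝ, ℝ)) (fun s : ℝ ↦ ((y, s) : N × ℝ)) 0)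
          ((chartAt (EuclideanSpace ℝ (Fin (m + 1))) i).symm p) +
        nn * μ ((chartAt (EuclideanSpace ℝ (Fin (m + 1))) i).symm p) ≤ 0 := by
        rw [hpz, hnndef]; exact hμH z
      have key := regionB_point_pos G G' hG hG'R hcyl hcyl' hψ (F i) (hF i) F' hF' hμ ha_s hχ_s hFF'
        (hF₁ i) (hF₂ i) hat hat' hat'' hnn hnn1 (hb1 i) hbib hbb1 hc₀.le hC0 hb'def hsst2 hsstC
        hsst0 hδ0 hδsst ht.1 hB (hχ01 t ht.1) (hχd1 t) hχd2a' hχd2b' hCKB' p hsh0 f10 g10 e10 e20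
        f20 g20 hμa hμb hμc hμHz
      rwa [hpz] at key
    · -- #### region A: `√δ < t ≤ ε_L`
      have ht0 : 0 < t := hsst0.trans hB
      have ht1 : t ≤ 1 := hA.trans hεLone
      obtain ⟨hχt, hχ', hχ''⟩ := hχ_zero t hB
      obtain ⟨ha', ha''⟩ := hader t ht0
      obtain ⟨⟨-, e2t, e3t, e4t, e5t, e6t⟩, ⟨f1t, -, -, -, -, f6t⟩, ⟨g1t, -, -, -, -, g6t⟩, hsht, -, -,
        -⟩ := hbd i z hz t ⟨by linarith only [ht0], ht1⟩
      have hm : m₀ ≤ G.scalarCurvature ((chartAt (EuclideanSpace ℝ (Fin (m + 1))) i).symm p, t) := by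
        rw [hpz]; exact hm₀le z t ⟨ht.1, by linarith only [hA, hεLε, hε]⟩
      have hQεL : 34000 * nn ^ 2 * bb ^ 8 * (1 + C) * εL ≤ m₀ := by
        have h := hεL2; rw [hQdef] at h; exact h
      have hQη : 34000 * nn ^ 2 * bb ^ 8 * (1 + C) * η ≤ m₀ := by
        have h := hη2; rw [hQdef] at h; exact h
      have key := regionA_point_pos G G' hG hG'R hcyl hcyl' hψ (F i) (hF i) F' hF' ha_s hχ_s hFF'
        (hF₁ i) (hF₂ i) hχt hχ' hχ'' (ha01 t).1 (ha01 t).2 ha' ha'' hnn hnn0 (hb1 i) hbib hbb1 hC0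
        hC4 hη0 hη1 ht0 hA hεLone hεL1 hQεL hQη hm₀ p hm hsht f1t g1t e10 e2t e3t e4t e5t e6t f10
        f6t g10 g6t
      rwa [hpz] at key

  -- ### Step 7: the conclusion
  refine ⟨G', hLC', δ / 10, εL, (εL + ε) / 2, hG'R, hcyl', by positivity, ?_, hεL0,
    by linarith only [hεLε, hε], by linarith only [hεLε, hε], ?_, hscal, ?_⟩
  · linarith only [hδsst, hsstεL, hεLε, hε, hδ0]
  · intro z t ht
    exact cylNormalDeform_val_of_eq_zero G hval
      (ha0on t (by rw [abs_of_pos (hεL0.trans ht)]; exact ht.le)) z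
  · intro z t ht v w
    have hat : a t = 1 := ha1on t (by rw [abs_of_nonneg ht.1]; linarith only [ht.2, hδsst, hsstδεL, hδ0])
    have hχt : χ t = t := hχlow t ht.2
    exact cylNormalDeform_hor_of_eq_one G hval hat hχt z v w

end Literature.Geometry.Riemannian

end
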